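import Summits.ResolutionOfSingularities.ResolutionOfSingularities.Theorems.FrobeniusLadderFInjectiveMacaulayficationPointFloorNotFullOfFedder
import Summits.ResolutionOfSingularities.ResolutionOfSingularities.Theorems.FrobeniusLadderFInjectiveMacaulayficationStrictTransformChartCI
import Summits.ResolutionOfSingularities.ResolutionOfSingularities.Theorems.FrobeniusLadderFInjectiveMacaulayficationCINotFullAtMaximalIdeal
import Summits.ResolutionOfSingularities.ResolutionOfSingularities.Theorems.FrobeniusLadderFInjectiveMacaulayficationLocalBlowupBadFibreFromCharts
import HarnessLib

/-!
# GENERIC POINT-FLOOR NON-FULLNESS FOR COMPLETE INTERSECTIONS: if ONE point-blow-up chart of `X = Spec k[x]/(F₁, …, F_c)` is presented by a prime ideal `J = (g₁, …, g_{c'})`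
# of strict transforms whose origin fails the CI Fedder test `(∏ g_l)^{p−1} ∈ (y₀^p, …, y_{n−1}^p)`, then EVERY blowing up of `Spec 𝒪_{X,v}` along `𝔪̃_v` has a NON-FULL
# stalk over the closed point — the CI twin of ✓ `PointFloorNotFullOfFedder` (any `p`, any `n`, any field)
# (crux `FInjectiveMacaulayfication` stmt-ResolutionOfSingularities-15315, chain w45a; res-L1-w45a-plan-1 RULING R23.11 (2) «FLOOR columns = CI twins of `PointFloorLegalOfIsolated` /
# `PointFloorNotFullOfFedder`»; seat res-L1-w45a-stub-2 g13)

[OURS · L1 W4.5a] Support file (`--supports stmt-ResolutionOfSingularities-15315 --as helper`); def-free; UNCONDITIONAL; replaces the role of NO printed item; NOT a statement of the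
manuscript; AI-written (AI review is weaker than expert review). Nothing of the crux is proved.

INPUT BINDERS (all elementary for a concrete bed). `F : Fin c → k[x₀..x_{n−1}]` (the bed, `F_l(0) = 0`), a chart index `i`, elements `Fs_l ∈ (F)` (ANY elements — typically a
generating set adapted to the chart, e.g. `P = 2F₁ − F₂`, `Q = F₂ − F₁` for BED CI-1) with strict transforms `θᵢ Fs_l = xᵢ^{μ_l} g_l`, such that `J = (g₁, …, g_{c'})` is PRIME,
`xᵢ ∉ J`, the total transforms `θᵢ F_l` lie in `J`, and the `g_l` vanish at the origin; the CI Fedder certificate `(∏ g_l)^{p−1} ∈ (x₀^p, …, x_{n−1}^p)` and an s.o.p. certificate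
`(x)^N ⊆ (g, hs)`, `c' + |hs| = n` at the chart origin.
* §1 `total_transform_mem` — `θᵢ(F) ⊆ J` from the generators.
* §2 ★★ `exists_point_over_vertex_not_fullCl` — a point of `Bl_𝔪 X = affineBlowup 𝔪̃` over the vertex `v` whose stalk is NOT `FullCl p`: the origin of the chart `D(x̄ᵢt) ≅ Spec k[y]/J`
  (✓ `StrictTransformChartCI.exists_ringEquiv_ci` ∘ ✓ `ReesChartFacts.exists_reesChartEquiv`), NOT FULL by ✓ `CINotFullAtMaximalIdeal.ci_not_clause_atMaximalIdeal_of_certificate` (the CI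
  Fedder NECESSITY engine ✓ `CIFedderNecessity`), placed by ✓ `TauFloorInputNotFull.exists_point_over_centre_not_fullCl`.
* §3 ★★ `pointFloor_not_full` — for EVERY blowing up `g : S′ → Spec 𝒪_{X,v}` along `𝔪̃|`: a point over the closed point with a NON-FULL stalk
  (✓ `TauFloorInputNotFull.exists_not_fullCl_of_isBlowup_comap_fromSpecStalk`).
[folklore assembly; cite: Fedder1983, Thm. 1.12 and Prop. 2.1; GortzWedhorn2020, Prop. 13.91 (2); StacksProject, Tag 0804]
-/

-- single-problem summit: the doubled namespace component is forced
set_option linter.dupNamespace false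

noncomputable section

namespace Summit.ResolutionOfSingularities.ResolutionOfSingularities.Theorems.FInjectiveMacaulayfication.PointFloorNotFullCI

open CategoryTheory CategoryTheory.Limits AlgebraicGeometry TopologicalSpace IsLocalRing MvPolynomial
open Literature.AlgebraicGeometry.Resolution
open Summit.ResolutionOfSingularities.ResolutionOfSingularities.Theorems.FInjectiveMacaulayfication
open SliceableCentre GermOfGlobalBlowup

variable (p : ℕ) [Fact p.Prime] (k : Type) [Field k] [CharP k p] {n c c' : ℕ}

/-! ## §1 The total transform of the bed lies in the chart ideal -/

omit [Fact p.Prime] [CharP k p] in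
/-- If the chart substitution sends every GENERATOR `F_l` of the bed ideal into `J`, it sends the whole ideal `(F)` into `J`. [plumbing] -/
theorem total_transform_mem (F : Fin c → MvPolynomial (Fin n) k) (i : Fin n) (J : Ideal (MvPolynomial (Fin n) k))
    (hθI : ∀ l, aeval (fun j : Fin n => if j = i then (X i : MvPolynomial (Fin n) k) else X j * X i) (F l) ∈ J) :
    ∀ s ∈ Ideal.span (Set.range F), (aeval fun j : Fin n => if j = i then (X i : MvPolynomial (Fin n) k) else X j * X i).toRingHom s ∈ J := by
  intro s hs
  have h1 : (aeval fun j : Fin n => if j = i then (X i : MvPolynomial (Fin n) k) else X j * X i).toRingHom s ∈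
      (Ideal.span (Set.range F)).map (aeval fun j : Fin n => if j = i then (X i : MvPolynomial (Fin n) k) else X j * X i).toRingHom :=
    Ideal.mem_map_of_mem _ hs
  rw [Ideal.map_span] at h1
  refine (Ideal.span_le.mpr ?_) h1
  rintro _ ⟨_, ⟨l, rfl⟩, rfl⟩
  exact hθI l

/-! ## §2 ★★ A non-FULL point over the vertex -/

set_option synthInstance.maxHeartbeats 200000 in
set_option maxHeartbeats 1600000 in
-- two ring equivalences onto the blow-up algebra + one localization transport (same budget as `PointFloorNotFullOfFedder`)
/-- ★★ **A point of `Bl_𝔪 X` over the vertex with a NON-FULL stalk, `X = V(F₁, …, F_c)` a complete intersection through the origin**: the origin of the chart `D(x̄ᵢt)`,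
presented as `Spec k[y]/J` with `J = (g₁, …, g_{c'})` the PRIME ideal of the strict transforms `θᵢ Fs_l = xᵢ^{μ_l} g_l` (`Fs_l ∈ (F)`, `xᵢ ∉ J`, `θᵢ(F) ⊆ J`), fails the per-stalk
clause by the CI Fedder criterion, necessity (`(∏ g_l)^{p−1} ∈ (y^p)`, expected dimension from the s.o.p. certificate `(y)^N ⊆ (g, hs)`).
[OURS · certificate engine; cite: Fedder1983, Thm. 1.12 and Prop. 2.1] -/
theorem exists_point_over_vertex_not_fullCl (F : Fin c → MvPolynomial (Fin n) k) (hF0 : ∀ l, constantCoeff (F l) = 0) (i : Fin n)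
    (Fs : Fin c' → MvPolynomial (Fin n) k) (hFs : ∀ l, Fs l ∈ Ideal.span (Set.range F))
    (gs : Fin c' → MvPolynomial (Fin n) k) (μ : Fin c' → ℕ)
    (hθF : ∀ l, aeval (fun j : Fin n => if j = i then (X i : MvPolynomial (Fin n) k) else X j * X i) (Fs l) = X i ^ μ l * gs l)
    (hθI : ∀ l, aeval (fun j : Fin n => if j = i then (X i : MvPolynomial (Fin n) k) else X j * X i) (F l) ∈ Ideal.span (Set.range gs))
    (hJ : (Ideal.span (Set.range gs)).IsPrime) (hXi : (X i : MvPolynomial (Fin n) k) ∉ Ideal.span (Set.range gs))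
    (hg0 : ∀ l, constantCoeff (gs l) = 0)
    (hfed : (∏ l, gs l) ^ (p - 1) ∈ Ideal.span (Set.range fun j : Fin n => (X j : MvPolynomial (Fin n) k) ^ p))
    (hs : List (MvPolynomial (Fin n) k)) (hhs : ∀ h ∈ hs, constantCoeff h = 0) (hlen : c' + hs.length = n) (N : ℕ)
    (hN : Ideal.span (Set.range (X : Fin n → MvPolynomial (Fin n) k)) ^ N ≤ Ideal.ofList (List.ofFn gs ++ hs))
    (v : Spec (.of (MvPolynomial (Fin n) k ⧸ Ideal.span (Set.range F))))
    (hv : v.asIdeal = Ideal.span (Set.range fun j : Fin n => Ideal.Quotient.mk (Ideal.span (Set.range F)) (X j))) :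
    ∃ b : ↥(affineBlowup (Ideal.span (Set.range fun j : Fin n => Ideal.Quotient.mk (Ideal.span (Set.range F)) (X j)))),
      (affineBlowup.π _).base b = v ∧
      ¬ FullCl p ((affineBlowup (Ideal.span (Set.range fun j : Fin n => Ideal.Quotient.mk (Ideal.span (Set.range F)) (X j)))).presheaf.stalk b) := by
  classical
  let I : Ideal (MvPolynomial (Fin n) k) := Ideal.span (Set.range F)
  set J : Ideal (MvPolynomial (Fin n) k) := Ideal.span (Set.range gs) with hJdef
  let x : Fin n → MvPolynomial (Fin n) k ⧸ I := fun j => Ideal.Quotient.mk I (X j)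
  haveI := hJ
  -- the chart ring `k[y]/J` and its identification with `A[𝔪/x̄_i]`
  obtain ⟨e₀, he₀⟩ := StrictTransformChartCI.exists_ringEquiv_ci (Ideal.Quotient.mk I) Ideal.Quotient.mk_surjective x (fun j => rfl)
    (I := I) (J := J) (fun s => Ideal.Quotient.eq_zero_iff_mem) hJ hXi
    (aeval fun j : Fin n => if j = i then (X i : MvPolynomial (Fin n) k) else X j * X i).toRingHom
    (fun a => MvPolynomial.algHom_C _ a) ((MvPolynomial.aeval_X _ i).trans (if_pos rfl))
    (fun j hj => (MvPolynomial.aeval_X _ j).trans (if_neg hj)) (total_transform_mem k F i J hθI) Fs gs μ hFs hθF le_rfl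
  have hxi : x i ∈ Ideal.span (Set.range x) := Ideal.subset_span ⟨i, rfl⟩
  obtain ⟨e, he⟩ := ReesChartFacts.exists_reesChartEquiv (Ideal.span (Set.range x)) (x i) hxi
  let E := e₀.trans e
  have hE : E (Ideal.Quotient.mk J (X i)) = algebraMap (MvPolynomial (Fin n) k ⧸ I) _ (x i) := by
    change e (e₀ (Ideal.Quotient.mk J (X i))) = _
    rw [he₀, he]
  -- the origin of the chart, transported
  set Q₀ : Ideal (MvPolynomial (Fin n) k ⧸ J) := Ideal.span (Set.range fun j : Fin n => Ideal.Quotient.mk J (X j)) with hQ₀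
  haveI hmax : Q₀.IsMaximal := QuotientOriginMaximal.isMaximal_span_range_mk_X k gs hg0
  let Q := Q₀.map E.toRingHom
  haveI hQ : Q.IsPrime := Ideal.map_isPrime_of_equiv E
  have hcomap : Q.comap E.toRingHom = Q₀ := Ideal.comap_map_of_bijective E.toRingHom E.bijective
  -- `x̄_i/1 ∈ Q`
  have hxQ : algebraMap (MvPolynomial (Fin n) k ⧸ I) _ (x i) ∈ Q := by
    rw [← hE]; exact Ideal.mem_map_of_mem _ (Ideal.subset_span ⟨i, rfl⟩)
  -- `¬ FullCl p` at `Q₀`: the CI Fedder criterion, necessity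
  have hbad₀ : ¬ FullCl p (Localization.AtPrime Q₀) := by
    intro hfull
    have hQ₀c : Q₀.comap (Ideal.Quotient.mk J) = Ideal.span (Set.range (X : Fin n → MvPolynomial (Fin n) k)) :=
      CINotFullAtMaximalIdeal.comap_origin_range k gs hg0
    have hIl : J = Ideal.ofList (List.ofFn gs) := (FRationalModification.Exchange.ofList_ofFn gs).symm
    have hfed' : (List.ofFn gs).prod ^ (p - 1) ∈ Ideal.span (Set.range fun j : Fin n => (X j : MvPolynomial (Fin n) k) ^ p) := by
      rw [List.prod_ofFn]; exact hfed
    have hhs' : ∀ h ∈ hs, h ∈ Ideal.span (Set.range (X : Fin n → MvPolynomial (Fin n) k)) := fun h hh =>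
      (QuotientOriginMaximal.mem_idealOfVars_iff k h).mpr (hhs h hh)
    have hlen' : (List.ofFn gs).length + hs.length = n := by rw [List.length_ofFn]; exact hlen
    exact CINotFullAtMaximalIdeal.ci_not_clause_atMaximalIdeal_of_certificate k n n p X J (List.ofFn gs) hs hIl Q₀ hQ₀c hfed' hhs' hlen' N hN
      hfull.2
  have hbad : ¬ FullCl p (Localization.AtPrime Q) :=
    LocalBlowupBadFibreFromCharts.not_fullCl_localization_of_ringEquiv p E Q₀ Q hcomap.symm hbad₀
  obtain ⟨b, hb, hbadb⟩ := TauFloorInputNotFull.exists_point_over_centre_not_fullCl _ _ hxi p Q hxQ hbad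
  refine ⟨b, ?_, hbadb⟩
  haveI hvmax : v.asIdeal.IsMaximal := by
    rw [hv]; exact QuotientOriginMaximal.isMaximal_span_range_mk_X k F hF0
  have h1 : v.asIdeal ≤ ((affineBlowup.π _).base b).asIdeal := by rw [hv]; exact hb
  exact (PrimeSpectrum.ext (hvmax.eq_of_le ((affineBlowup.π _).base b).2.ne_top h1)).symm

/-! ## §3 ★★ For every blowing up along the point floor: NOT FULL -/

/-- ★★ **GENERIC POINT-FLOOR NON-FULLNESS FOR COMPLETE INTERSECTIONS**: under the chart data of `exists_point_over_vertex_not_fullCl`, for every blowing up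
`g : S′ → Spec 𝒪_{X,v}` along `𝔪̃|` there is a point `s ∈ S′` over the closed point whose local ring is NOT `FullCl p`. [OURS · assembly; cite: GortzWedhorn2020, Prop. 13.91 (2)] -/
theorem pointFloor_not_full (F : Fin c → MvPolynomial (Fin n) k) (hF0 : ∀ l, constantCoeff (F l) = 0) (i : Fin n)
    (Fs : Fin c' → MvPolynomial (Fin n) k) (hFs : ∀ l, Fs l ∈ Ideal.span (Set.range F))
    (gs : Fin c' → MvPolynomial (Fin n) k) (μ : Fin c' → ℕ)
    (hθF : ∀ l, aeval (fun j : Fin n => if j = i then (X i : MvPolynomial (Fin n) k) else X j * X i) (Fs l) = X i ^ μ l * gs l)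
    (hθI : ∀ l, aeval (fun j : Fin n => if j = i then (X i : MvPolynomial (Fin n) k) else X j * X i) (F l) ∈ Ideal.span (Set.range gs))
    (hJ : (Ideal.span (Set.range gs)).IsPrime) (hXi : (X i : MvPolynomial (Fin n) k) ∉ Ideal.span (Set.range gs))
    (hg0 : ∀ l, constantCoeff (gs l) = 0)
    (hfed : (∏ l, gs l) ^ (p - 1) ∈ Ideal.span (Set.range fun j : Fin n => (X j : MvPolynomial (Fin n) k) ^ p))
    (hs : List (MvPolynomial (Fin n) k)) (hhs : ∀ h ∈ hs, constantCoeff h = 0) (hlen : c' + hs.length = n) (N : ℕ)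
    (hN : Ideal.span (Set.range (X : Fin n → MvPolynomial (Fin n) k)) ^ N ≤ Ideal.ofList (List.ofFn gs ++ hs))
    (v : Spec (.of (MvPolynomial (Fin n) k ⧸ Ideal.span (Set.range F))))
    (hv : v.asIdeal = Ideal.span (Set.range fun j : Fin n => Ideal.Quotient.mk (Ideal.span (Set.range F)) (X j)))
    (S' : Scheme.{0}) (g' : S' ⟶ Spec ((Spec (.of (MvPolynomial (Fin n) k ⧸ Ideal.span (Set.range F)))).presheaf.stalk v))
    (hg' : IsBlowup g' ((affineBlowup.idealSheaf (Ideal.span (Set.range fun j : Fin n => Ideal.Quotient.mk (Ideal.span (Set.range F)) (X j)))).comap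
      ((Spec (.of (MvPolynomial (Fin n) k ⧸ Ideal.span (Set.range F)))).fromSpecStalk v))) :
    ∃ s : S', g'.base s = closedPoint ((Spec (.of (MvPolynomial (Fin n) k ⧸ Ideal.span (Set.range F)))).presheaf.stalk v) ∧ ¬ FullCl p (S'.presheaf.stalk s) :=
  TauFloorInputNotFull.exists_not_fullCl_of_isBlowup_comap_fromSpecStalk p v (affineBlowup.isBlowup _)
    (exists_point_over_vertex_not_fullCl p k F hF0 i Fs hFs gs μ hθF hθI hJ hXi hg0 hfed hs hhs hlen N hN v hv) hg'

end Summit.ResolutionOfSingularities.ResolutionOfSingularities.Theorems.FInjectiveMacaulayfication.PointFloorNotFullCI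

end
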